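import Literature.NumberTheory.LFunctions.XiJensenRows
import Summits.RiemannHypothesis.RiemannHypothesis.Theses.JensenLogBand
import HarnessLib

/-!
# Route JensenLogBand, EDGE crux `XiDerivEdgeReal` — the COUNTING DOWNGRADE glue (plan (b); RH-FREE)

Cell rh-jensen, LADDER-RH rung J-P(P3) «log band», crux stmt-RiemannHypothesis-19912 (`XiDerivEdgeReal`:
zeros of `ξ₁⁽ⁿ⁾` in the edge annulus are real). Plan (b) of the crux text: «a factorised zero count
`≤ N(n)` on the disc of radius `64(n/log n)²` (argument principle on one clean circle) plus `N(n)` sign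
changes of `t ↦ Re ξ₁⁽ⁿ⁾(−t²)` below that radius force all zeros in the disc to be real (pigeonhole,
PROVED)». This file puts the PROVED pigeonhole in the tree (rh-jensen-idea-1 g4's
`real_zeros_of_count_and_signChanges`, HOME/rh-jensen-idea-1/LogBandItems.lean v3, verbatim with
attribution), the realness of every `ξ₁⁽ⁿ⁾` on the real axis (`im_iteratedDeriv_xiSq_ofReal`, via the
Schwarz reflection `iteratedDeriv_xiSq_conj`), and the composition
`xiDerivEdgeReal_of_discCounting : (count + signs from some n₁ on) → …Theses.JensenLogBand.XiDerivEdgeReal`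
— so a plan-(b) line needs exactly two analytic stubs (COUNT, SIGNS). Labels: RH-FREE; WHAT THIS IS NOT:
the two analytic inputs are NOT proved here; nothing here bears on zeros of `ζ` off the line or the
truth of RH. (prover-rh-jensen-eng-2-g5-0, 2026-08-27; pigeonhole lemma by planner-rh-jensen-idea-1-g4-0.)
-/

noncomputable section

open Complex

set_option linter.dupNamespace false

namespace Summit.RiemannHypothesis.RiemannHypothesis.Theorems.JensenPolynomials.LogBand

open Literature.NumberTheory.LFunctions
open scoped ComplexConjugate

/-! ## `ξ₁⁽ⁿ⁾` is real on the real axis -/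

/-- Schwarz reflection for every derivative of `ξ₁`: `ξ₁⁽ⁿ⁾(z̄) = conj ξ₁⁽ⁿ⁾(z)` (from the tree's
`xiSq_conj`; rh-jensen-idea-1 g3/g4, verbatim). RH-FREE. -/
theorem iteratedDeriv_xiSq_conj (n : ℕ) (z : ℂ) :
    iteratedDeriv n xiSq (conj z) = conj (iteratedDeriv n xiSq z) := by
  induction n generalizing z with
  | zero => simpa using xiSq_conj z
  | succ n ih =>
    have hfun : iteratedDeriv n xiSq = conj ∘ iteratedDeriv n xiSq ∘ conj := by
      funext w
      rw [Function.comp_apply, Function.comp_apply, ih w, Complex.conj_conj]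
    rw [iteratedDeriv_succ]
    have h1 : HasDerivAt (iteratedDeriv n xiSq) (deriv (iteratedDeriv n xiSq) z) z :=
      ((Literature.Analysis.Complex.differentiable_iteratedDeriv_of_entire differentiable_xiSq n) z).hasDerivAt
    have h2 := h1.conj_conj
    rw [← hfun] at h2
    exact h2.deriv

/-- Every `ξ₁⁽ⁿ⁾` is real on the real axis: `Im ξ₁⁽ⁿ⁾(x) = 0` for real `x`. RH-FREE. -/
theorem im_iteratedDeriv_xiSq_ofReal (n : ℕ) (x : ℝ) : (iteratedDeriv n xiSq (x : ℂ)).im = 0 := by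
  rw [← Complex.conj_eq_iff_im]
  have := iteratedDeriv_xiSq_conj n (x : ℂ)
  rw [Complex.conj_ofReal] at this
  exact this.symm

/-! ## The pigeonhole lemma (rh-jensen-idea-1 g4, verbatim) -/

/-- **Counting downgrade, the pigeonhole** (planner-rh-jensen-idea-1-g4-0, LogBandItems.lean v3, verbatim):
for any continuous `G : ℂ → ℂ` real on `ℝ`, a factorised zero count `≤ N` on the closed disc of radius
`R` (`G = (∏_{a ∈ S} (· − a))·h`, `card S ≤ N`, `h ≠ 0` on the disc) plus `N` sign changes of
`t ↦ Re G(−t²)` at points `0 < t 0 < … < t N`, `(t N)² ≤ R`, force every zero of `G` in the disc to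
be real (IVT gives `N` distinct real zeros in the disc; they exhaust `S`). RH-FREE. -/
theorem real_zeros_of_count_and_signChanges {G : ℂ → ℂ} (hG : Continuous G)
    (hreal : ∀ x : ℝ, (G (x : ℂ)).im = 0) {R : ℝ} {N : ℕ}
    (S : Multiset ℂ) (h : ℂ → ℂ) (hcard : Multiset.card S ≤ N)
    (hh : ∀ z : ℂ, ‖z‖ ≤ R → h z ≠ 0)
    (hfac : ∀ z : ℂ, G z = ((S.map fun a => z - a).prod) * h z)
    (t : ℕ → ℝ) (ht : StrictMono t) (ht0 : 0 < t 0) (htN : (t N) ^ 2 ≤ R)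
    (hsign : ∀ i : ℕ, i < N →
      (G (-((t i : ℝ) : ℂ) ^ 2)).re * (G (-((t (i + 1) : ℝ) : ℂ) ^ 2)).re < 0) :
    ∀ z : ℂ, ‖z‖ ≤ R → G z = 0 → z.im = 0 := by
  classical
  intro z hzR hGz
  -- the real-variable function along the negative axis
  let f : ℝ → ℝ := fun u => (G (-((u : ℝ) : ℂ) ^ 2)).re
  have hfc : Continuous f :=
    Complex.continuous_re.comp (hG.comp ((Complex.continuous_ofReal.pow 2).neg))
  -- intermediate value theorem on each sign-change interval
  have hivt : ∀ i : ℕ, i < N → ∃ u : ℝ, t i < u ∧ u < t (i + 1) ∧ f u = 0 := by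
    intro i hi
    have hlt : t i < t (i + 1) := ht (Nat.lt_succ_self i)
    have hprod : f (t i) * f (t (i + 1)) < 0 := hsign i hi
    rcases mul_neg_iff.mp hprod with ⟨ha, hb⟩ | ⟨ha, hb⟩
    · have hmem : (0 : ℝ) ∈ Set.Ioo (f (t (i + 1))) (f (t i)) := ⟨hb, ha⟩
      obtain ⟨u, hu, hfu⟩ := intermediate_value_Ioo' hlt.le hfc.continuousOn hmem
      exact ⟨u, hu.1, hu.2, hfu⟩
    · have hmem : (0 : ℝ) ∈ Set.Ioo (f (t i)) (f (t (i + 1))) := ⟨ha, hb⟩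
      obtain ⟨u, hu, hfu⟩ := intermediate_value_Ioo hlt.le hfc.continuousOn hmem
      exact ⟨u, hu.1, hu.2, hfu⟩
  choose! s hs using hivt
  have hspos : ∀ i : ℕ, i < N → 0 < s i := fun i hi =>
    lt_trans (lt_of_lt_of_le ht0 (ht.monotone (Nat.zero_le i))) (hs i hi).1
  have hsR : ∀ i : ℕ, i < N → (s i) ^ 2 ≤ R := by
    intro i hi
    have h1 : s i ≤ t N := le_trans (hs i hi).2.1.le (ht.monotone (Nat.succ_le_of_lt hi))
    have h0 : 0 ≤ s i := (hspos i hi).le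
    nlinarith [mul_le_mul h1 h1 h0 (h0.trans h1)]
  have hsmono : ∀ i j : ℕ, i < j → j < N → s i < s j := by
    intro i j hij hj
    calc s i < t (i + 1) := (hs i (lt_trans hij hj)).2.1
      _ ≤ t j := ht.monotone (Nat.succ_le_of_lt hij)
      _ < s j := (hs j hj).1
  -- the produced real zeros
  have hzero : ∀ i : ℕ, i < N → G (-((s i : ℝ) : ℂ) ^ 2) = 0 := by
    intro i hi
    apply Complex.ext
    · simpa using (hs i hi).2.2
    · have e : (((-(s i ^ 2) : ℝ)) : ℂ) = -((s i : ℝ) : ℂ) ^ 2 := by push_cast; ring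
      have := hreal (-(s i ^ 2))
      rw [e] at this
      simpa using this
  -- every zero in the disc is a root of the multiset
  have hmemS : ∀ w : ℂ, ‖w‖ ≤ R → G w = 0 → w ∈ S := by
    intro w hw hGw
    have hprod : (S.map fun a => w - a).prod = 0 := by
      have h1 := hfac w
      rw [hGw] at h1
      rcases mul_eq_zero.mp h1.symm with h0 | h0
      · exact h0
      · exact absurd h0 (hh w hw)
    rw [Multiset.prod_eq_zero_iff, Multiset.mem_map] at hprod
    obtain ⟨a, haS, hwa⟩ := hprod
    have : w = a := sub_eq_zero.mp hwa
    exact this ▸ haS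
  -- the finset of the N distinct real zeros found
  let T : Finset ℂ := (Finset.range N).image fun i => -((s i : ℝ) : ℂ) ^ 2
  have hinj : Set.InjOn (fun i : ℕ => -((s i : ℝ) : ℂ) ^ 2) (Finset.range N : Set ℕ) := by
    intro i hi j hj hij
    simp only [Finset.coe_range, Set.mem_Iio] at hi hj
    have hsq : ((s i : ℝ) : ℂ) ^ 2 = ((s j : ℝ) : ℂ) ^ 2 := neg_inj.mp hij
    have hsq' : (s i) ^ 2 = (s j) ^ 2 := by exact_mod_cast hsq
    have habs : s i = s j := by
      have h1 := hspos i hi; have h2 := hspos j hj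
      have hab : |s i| = |s j| := (sq_eq_sq_iff_abs_eq_abs (s i) (s j)).mp hsq'
      rwa [abs_of_pos h1, abs_of_pos h2] at hab
    by_contra hne
    rcases lt_or_gt_of_ne hne with hlt | hlt
    · exact absurd habs (ne_of_lt (hsmono i j hlt hj))
    · exact absurd habs.symm (ne_of_lt (hsmono j i hlt hi))
  have hTcard : T.card = N := by
    simp only [T]
    rw [Finset.card_image_of_injOn hinj, Finset.card_range]
  have hTsub : T ⊆ S.toFinset := by
    intro w hw
    simp only [T, Finset.mem_image, Finset.mem_range] at hw
    obtain ⟨i, hi, rfl⟩ := hw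
    rw [Multiset.mem_toFinset]
    refine hmemS _ ?_ (hzero i hi)
    have : ‖-((s i : ℝ) : ℂ) ^ 2‖ = (s i) ^ 2 := by
      rw [norm_neg, norm_pow, Complex.norm_real, Real.norm_eq_abs, abs_of_pos (hspos i hi)]
    rw [this]
    exact hsR i hi
  have hScard : S.toFinset.card ≤ N := le_trans (Multiset.toFinset_card_le S) hcard
  have hTeq : T = S.toFinset :=
    Finset.eq_of_subset_of_card_le hTsub (by rw [hTcard]; exact hScard)
  -- conclude
  have hzS : z ∈ S.toFinset := Multiset.mem_toFinset.mpr (hmemS z hzR hGz)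
  rw [← hTeq] at hzS
  simp only [T, Finset.mem_image, Finset.mem_range] at hzS
  obtain ⟨i, _, rfl⟩ := hzS
  rw [← Complex.ofReal_pow, ← Complex.ofReal_neg, Complex.ofReal_im]

/-! ## Specialisation to `ξ₁⁽ⁿ⁾` and the EDGE crux by name -/

/-- **Disc form for `ξ₁⁽ⁿ⁾`**: a factorised zero count `≤ N` of `ξ₁⁽ⁿ⁾` on the closed disc of radius
`R` plus `N` sign changes of `t ↦ Re ξ₁⁽ⁿ⁾(−t²)` at `0 < t 0 < … < t N`, `(t N)² ≤ R` ⇒ every zero of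
`ξ₁⁽ⁿ⁾` with `‖z‖ ≤ R` is real. RH-FREE. -/
theorem xiDeriv_discReal_of_count_and_signChanges (n : ℕ) {R : ℝ} {N : ℕ}
    (S : Multiset ℂ) (h : ℂ → ℂ) (hcard : Multiset.card S ≤ N)
    (hh : ∀ z : ℂ, ‖z‖ ≤ R → h z ≠ 0)
    (hfac : ∀ z : ℂ, iteratedDeriv n xiSq z = ((S.map fun a => z - a).prod) * h z)
    (t : ℕ → ℝ) (ht : StrictMono t) (ht0 : 0 < t 0) (htN : (t N) ^ 2 ≤ R)
    (hsign : ∀ i : ℕ, i < N →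
      (iteratedDeriv n xiSq (-((t i : ℝ) : ℂ) ^ 2)).re *
        (iteratedDeriv n xiSq (-((t (i + 1) : ℝ) : ℂ) ^ 2)).re < 0) :
    ∀ z : ℂ, ‖z‖ ≤ R → iteratedDeriv n xiSq z = 0 → z.im = 0 :=
  real_zeros_of_count_and_signChanges
    ((Literature.Analysis.Complex.differentiable_iteratedDeriv_of_entire differentiable_xiSq n).continuous)
    (im_iteratedDeriv_xiSq_ofReal n) S h hcard hh hfac t ht ht0 htN hsign

/-- **The EDGE crux from COUNT + SIGNS (plan (b) composition, kernel-checked):** if from some `n₁` on,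
for every `n ≥ n₁` there are `N`, a factorisation of `ξ₁⁽ⁿ⁾` with at most `N` roots responsible for
the zeros in the disc `‖z‖ ≤ 64 (n/log n)²`, and `N` sign changes of `Re ξ₁⁽ⁿ⁾(−t²)` below that
radius, then `…Theses.JensenLogBand.XiDerivEdgeReal` holds (the inner radius `chainRadius n` is not
even needed). RH-FREE. -/
theorem xiDerivEdgeReal_of_discCounting
    (H : ∃ n₁ : ℕ, ∀ n : ℕ, n₁ ≤ n → ∃ (N : ℕ) (S : Multiset ℂ) (h : ℂ → ℂ) (t : ℕ → ℝ),
      Multiset.card S ≤ N ∧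
      (∀ z : ℂ, ‖z‖ ≤ 64 * ((n : ℝ) / Real.log n) ^ 2 → h z ≠ 0) ∧
      (∀ z : ℂ, iteratedDeriv n xiSq z = ((S.map fun a => z - a).prod) * h z) ∧
      StrictMono t ∧ 0 < t 0 ∧ (t N) ^ 2 ≤ 64 * ((n : ℝ) / Real.log n) ^ 2 ∧
      (∀ i : ℕ, i < N →
        (iteratedDeriv n xiSq (-((t i : ℝ) : ℂ) ^ 2)).re *
          (iteratedDeriv n xiSq (-((t (i + 1) : ℝ) : ℂ) ^ 2)).re < 0)) :
    Summit.RiemannHypothesis.RiemannHypothesis.Theses.JensenLogBand.XiDerivEdgeReal := by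
  unfold Summit.RiemannHypothesis.RiemannHypothesis.Theses.JensenLogBand.XiDerivEdgeReal
  obtain ⟨n₁, hn₁⟩ := H
  refine ⟨n₁, fun n hn z hz _ hhi => ?_⟩
  obtain ⟨N, S, h, t, hcard, hh, hfac, ht, ht0, htN, hsign⟩ := hn₁ n hn
  exact xiDeriv_discReal_of_count_and_signChanges n S h hcard hh hfac t ht ht0 htN hsign z hhi hz

end Summit.RiemannHypothesis.RiemannHypothesis.Theorems.JensenPolynomials.LogBand
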